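import Summits.ValiantsHypothesis.ValiantsHypothesis.Theorems.LacunarySymmetroidMatrixDescartesOverlapSector

/-!
# `MatrixDescartes` — root-free rays in coefficient currency (ends with rank-deficient letters)

HONEST FRAMING.  Object-search cell `pub-symmetroid`, crux `Theses.LacunarySymmetroid.MatrixDescartes` (ledger item
`stmt-ValiantsHypothesis-18050`, route `LacunarySymmetroid`; seat `val-sym-mdr-p2`, gen 13).  The crux implies `VP ≠ VNP`
by the route's assembly; NOTHING here is progress on it, and nothing here is a claim about `VP ≠ VNP`, `DoorA26` /
`DoorA34` or the cell's registers.  Sequel of `…OverlapSector` (rays `no_root_below_of_bot` / `no_root_above_of_top` need a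
CONDITIONED extreme letter: the pure power `det S·x^(m d)` must dominate).

THIS FILE: the same two rays in COEFFICIENT currency, for ANY real polynomial — if at one point `p > 0` the LOWEST coefficient
dominates the absolute mass of all others, there is no zero in `(0, p]` (`no_root_below_of_coeff`); if at `q > 0` the HIGHEST
coefficient dominates, there is no zero in `[q, ∞)` (`no_root_above_of_coeff`) — monotone transport of the one-point
certificate (`sum_mul_pow_lt_below/above`).  USE: the ends of a live-set cover when the extreme letter is rank-deficient
(census ends are: memo OVERLAP-LAW §4b), where the extreme non-zero coefficient of `det F` sits at a mixed exponent
(`ρ·d_t + (m−ρ)·d'`, cf. `…OverlapRankOne`: `det F = det F_¬t + C a·X^(d t)·wᵀadj(F_¬t)w`); combine with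
`card_posRoots_le_of_windowBounds`.  [folklore]
-/

-- `Summit.ValiantsHypothesis.ValiantsHypothesis.…` repeats a component by the D-0017 layout (single-conjunct summit).
set_option linter.dupNamespace false

namespace Summit.ValiantsHypothesis.ValiantsHypothesis.Theorems.LacunarySymmetroidMatrixDescartes.Overlap

open Polynomial Finset Set
open scoped BigOperators

/-! ## §21 Rays in coefficient currency -/

/-- **Bottom ray, coefficient currency.**  If every exponent in the support of `P` is `≥ n₀` and at `p > 0`
`∑_{n ∈ supp P, n ≠ n₀} |coeff P n|·p^n < |coeff P n₀|·p^n₀`, then `P` has no zero in `(0, p]`. [folklore] -/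
theorem no_root_below_of_coeff (P : ℝ[X]) (n₀ : ℕ) (hmin : ∀ n ∈ P.support, n₀ ≤ n) {p : ℝ}
    (hdom : ∑ n ∈ P.support.filter (fun n => n ≠ n₀), |P.coeff n| * p ^ n < |P.coeff n₀| * p ^ n₀)
    {x : ℝ} (hx : 0 < x) (hxp : x ≤ p) : ¬ P.IsRoot x := by
  classical
  intro hroot
  have hx' := sum_mul_pow_lt_below (P.support.filter (fun n => n ≠ n₀)) (fun n => |P.coeff n|)
    (fun n _ => abs_nonneg _) id n₀ (fun n hn => hmin n (Finset.mem_filter.1 hn).1) hx hxp hdom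
  refine RobustDescartes.eval_ne_zero_of_survivor P.support P.coeff id n₀ hx.le ?_ ?_
  · have hsurv : ∑ i ∈ P.support.filter (fun i => (id i) = n₀), P.coeff i = P.coeff n₀ := by
      by_cases h0 : n₀ ∈ P.support
      · rw [Finset.sum_eq_single_of_mem n₀ (by rw [Finset.mem_filter]; exact ⟨h0, rfl⟩)
          (fun n hn hne => by rw [Finset.mem_filter] at hn; exact absurd hn.2 hne)]
      · have : P.coeff n₀ = 0 := by rwa [mem_support_iff, not_not] at h0
        rw [this]
        refine Finset.sum_eq_zero fun n hn => ?_
        rw [Finset.mem_filter] at hn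
        have hn' : n = n₀ := hn.2
        rw [hn', this]
    rw [hsurv]
    simpa only [id] using hx'
  · simp only [id]
    rw [← P.as_sum_support_C_mul_X_pow]; exact hroot

/-- **Top ray, coefficient currency.**  If every exponent in the support of `P` is `≤ N` and at `q > 0`
`∑_{n ∈ supp P, n ≠ N} |coeff P n|·q^n < |coeff P N|·q^N`, then `P` has no zero in `[q, ∞)`. [folklore] -/
theorem no_root_above_of_coeff (P : ℝ[X]) (N : ℕ) (hmax : ∀ n ∈ P.support, n ≤ N) {q : ℝ} (hq : 0 < q)
    (hdom : ∑ n ∈ P.support.filter (fun n => n ≠ N), |P.coeff n| * q ^ n < |P.coeff N| * q ^ N)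
    {x : ℝ} (hqx : q ≤ x) : ¬ P.IsRoot x := by
  classical
  intro hroot
  have hx : 0 < x := hq.trans_le hqx
  have hx' := sum_mul_pow_lt_above (P.support.filter (fun n => n ≠ N)) (fun n => |P.coeff n|)
    (fun n _ => abs_nonneg _) id N (fun n hn => hmax n (Finset.mem_filter.1 hn).1) hq hqx hdom
  refine RobustDescartes.eval_ne_zero_of_survivor P.support P.coeff id N hx.le ?_ ?_
  · have hsurv : ∑ i ∈ P.support.filter (fun i => (id i) = N), P.coeff i = P.coeff N := by
      by_cases h0 : N ∈ P.support
      · rw [Finset.sum_eq_single_of_mem N (by rw [Finset.mem_filter]; exact ⟨h0, rfl⟩)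
          (fun n hn hne => by rw [Finset.mem_filter] at hn; exact absurd hn.2 hne)]
      · have : P.coeff N = 0 := by rwa [mem_support_iff, not_not] at h0
        rw [this]
        refine Finset.sum_eq_zero fun n hn => ?_
        rw [Finset.mem_filter] at hn
        have hn' : n = N := hn.2
        rw [hn', this]
    rw [hsurv]
    simpa only [id] using hx'
  · simp only [id]
    rw [← P.as_sum_support_C_mul_X_pow]; exact hroot

end Summit.ValiantsHypothesis.ValiantsHypothesis.Theorems.LacunarySymmetroidMatrixDescartes.Overlap
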